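import Literature.Analysis.FluidPDE.LaplaceDivFormRoundOne
import Literature.Analysis.FluidPDE.HeatDivFormGradientL2
import Literature.Analysis.FunctionSpaces.SobolevDomainProofs
import Mathlib.Analysis.Calculus.ContDiff.Convolution
import HarnessLib

/-!
# Very weak solutions of `Δf = div F` with `f, F ∈ L²` are `W^{1,2}` inside, with the bound

Analysis/FluidPDE proofs file (theorems only; no definitions, no named facts). The elliptic
companion of `HeatDivFormGradientL2`: the interior `W^{1,2}` estimate for **very weak**
(distributional, `L²`) solutions of the Poisson equation in divergence form on a ball of `ℝ³`,

  `f ∈ L²(B_R)`, `F ∈ L²(B_R; ℝ³)`, `∫_{B_R} f Δφ = -∫_{B_R} ⟪F, ∇φ⟫` for all `φ ∈ C_c^∞(B_R)`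
  `⟹ f ∈ W^{1,2}(B_ρ)` with `‖∇f‖_{L²(B_ρ)} ≤ C(ρ, R) (‖f‖_{L²(B_R)} + ‖F‖_{L²(B_R)})`, `ρ < R`,

the constant being fixed before the centre and the solution (`exists_weakGrad_of_veryWeak`). This
is the step which, in Serrin's bootstrap for bounded Navier–Stokes solutions (Serrin 1962;
Lemarié-Rieusset 2016, Thm. 13.1, Step 3: "`∇ ∧ ω = -Δu`", so that bounds on derivatives of the
vorticity give bounds on one more derivative of the velocity), converts `∂^γω ∈ L²` into
`∂^γ∇u ∈ L²`: the velocity derivative `v = ∂^γu_b` is only known to be a function, and it solves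
`Δv = div(∂^γA_{b·})` (`A = ∇u - ∇uᵀ`) in the sense of distributions. The `W^{1,2}` class, with
the weak equation in the gradient form `∫ ⟨∇f, ∇φ⟩ = ∫ ⟨F, ∇φ⟩`, is exactly the input of the
tree's elliptic estimates on balls (`Caccioppoli.sq_integral_le`,
`LaplaceDivFormRoundOne.exists_eLpNorm_six_le`, the De Giorgi estimate
`LaplaceDivFormInteriorHolder_holds`).

## Proof (Gilbarg–Trudinger 2001, §7.2–7.3 and the Caccioppoli inequality; standard)

Mollify: `fₙ = ψₙ ⋆ f̃`, `Fₙ = ψₙ ⋆ F̃` (`f̃, F̃` the extensions by zero, `ψₙ` normalised bumps of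
radius `→ 0`). On `B_{R₁}`, `R₁ = (ρ + R)/2`, and for small radius, `Δfₙ = div Fₙ` **pointwise**
(the Laplacian falls on the bump, `laplacian_integral_mul_comp_sub`; the very weak equation is
tested with the reflected translate `ψₙ(x - ·)`, a test function on `B_R`; the derivative goes back
onto the mollification of `F`, `fderiv_integral_smul_comp_sub_apply`). Hence `fₙ` is a smooth, in
particular `W^{1,2}`, weak solution of `Δfₙ = div Fₙ` on `B_{R₁}` (two integrations by parts
without boundary, `integral_inner_laplacian_add_eq_zero`, `integral_fderiv_apply_eq_zero`), and the
tree's Caccioppoli bound with a centre-free radial cut-off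
(`LaplaceDivFormRoundOne.eLpNorm_weakGrad_le`) gives
`‖∇fₙ‖_{L²(B_ρ)} ≤ √10 K ‖fₙ‖_{L²} + 2‖Fₙ‖_{L²} ≤ √10 K ‖f‖_{L²(B_R)} + 2 ‖F‖_{L²(B_R)}`
uniformly in `n` (mollification contracts `L²` norms). Since `fₙ → f̃` in `L²`
(`FunctionSpaces.tendsto_eLpNorm_normed_convolution_sub_self`), for a test function `φ` on `B_ρ`,
`|∫ (∂ᵥφ) f| = lim |∫ (∂ᵥφ) fₙ| = lim |∫ φ ∂ᵥfₙ| ≤ ‖v‖ M ‖φ‖_{L²(B_ρ)}`, and the Riesz–Fréchet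
theorem on test functions (`HeatDivForm.exists_memLp_two_repr_of_test_bound`) produces the weak
partial derivatives `∂ⱼf ∈ L²(B_ρ)` with `‖∂ⱼf‖ ≤ M`; they assemble into a weak Fréchet
derivative, and the gradient-form weak equation on `B_ρ` follows from the very weak one.

## References

* D. Gilbarg, N. S. Trudinger, *Elliptic Partial Differential Equations of Second Order* (2001),
  §7.2 (mollifiers), §7.3 (weak derivatives), proof of Thm. 8.17 / (8.38) (Caccioppoli).
  [`GilbargTrudinger2001`]
* J. Serrin, *On the interior regularity of weak solutions of the Navier–Stokes equations*, Arch.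
  Rational Mech. Anal. 9 (1962) 187–195. [`Serrin1962`]
* P. G. Lemarié-Rieusset, *The Navier–Stokes Problem in the 21st Century* (2016), Thm. 13.1,
  Step 3. [`LemarieRieusset2016`]
-/

noncomputable section

open MeasureTheory Set Function Filter Topology TopologicalSpace Metric
open scoped NNReal ENNReal RealInnerProductSpace Laplacian Convolution

namespace Literature.Analysis.FluidPDE

namespace LaplaceVeryWeak

open Literature.Analysis.FunctionSpaces SerrinBoundedHolder LaplaceDivFormRoundOne LaplaceDivFormLocalisation

/-! ### Mollification by normalised bumps, written as an integral against the data -/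

/-- The mollification of a vector field as an integral against the data:
`(ψ ⋆ H)(x) = ∫ ψ(x - z) • H(z) dz`. [folklore] -/
theorem normed_convolution_eq_integral_smul (ψ : ContDiffBump (0 : (EuclideanSpace ℝ (Fin 3)))) (H : (EuclideanSpace ℝ (Fin 3)) → (EuclideanSpace ℝ (Fin 3))) (x : (EuclideanSpace ℝ (Fin 3))) :
    (ψ.normed volume ⋆[ContinuousLinearMap.lsmul ℝ ℝ, volume] H) x =
      ∫ z, ψ.normed volume (x - z) • H z := by
  rw [convolution_def]
  simp only [ContinuousLinearMap.lsmul_apply]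
  rw [← integral_sub_left_eq_self (fun t => ψ.normed volume t • H (x - t)) (μ := volume) x]
  refine integral_congr_ae (Eventually.of_forall fun z => ?_)
  simp only [sub_sub_cancel]

/-- Coordinates of the mollified vector field are the mollified coordinates, as integrals against
the data: `(ψ ⋆ H)(x)ⱼ = ∫ H(z)ⱼ ψ(x - z) dz` (for `H ∈ L¹`). [folklore] -/
theorem normed_convolution_apply_coord (ψ : ContDiffBump (0 : (EuclideanSpace ℝ (Fin 3)))) {H : (EuclideanSpace ℝ (Fin 3)) → (EuclideanSpace ℝ (Fin 3))}
    (hH : Integrable H volume) (x : (EuclideanSpace ℝ (Fin 3))) (j : Fin 3) :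
    (ψ.normed volume ⋆[ContinuousLinearMap.lsmul ℝ ℝ, volume] H) x j =
      ∫ z, H z j * ψ.normed volume (x - z) := by
  rw [normed_convolution_eq_integral_smul]
  have hψc : Continuous (ψ.normed (volume : Measure (EuclideanSpace ℝ (Fin 3)))) := ψ.continuous_normed
  have hi : Integrable (fun z => ψ.normed volume (x - z) • H z) volume := by
    obtain ⟨C, hC⟩ := hψc.bounded_above_of_compact_support (ψ.hasCompactSupport_normed (μ := volume))
    refine (hH.norm.const_mul C).mono' ?_ (Eventually.of_forall fun z => ?_)
    · exact (hψc.comp (continuous_const.sub continuous_id)).aestronglyMeasurable.smul hH.1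
    · rw [norm_smul]
      exact mul_le_mul_of_nonneg_right (hC _) (norm_nonneg _)
  have h := ContinuousLinearMap.integral_comp_comm (EuclideanSpace.proj j : (EuclideanSpace ℝ (Fin 3)) →L[ℝ] ℝ) hi
  have hpr : ∀ w : (EuclideanSpace ℝ (Fin 3)), (EuclideanSpace.proj j : (EuclideanSpace ℝ (Fin 3)) →L[ℝ] ℝ) w = w j := fun w => rfl
  simp only [hpr] at h
  rw [← h]
  refine integral_congr_ae (Eventually.of_forall fun z => ?_)
  show (ψ.normed volume (x - z) • H z) j = H z j * ψ.normed volume (x - z)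
  rw [PiLp.smul_apply, smul_eq_mul, mul_comm]

/-- The extension by zero of an `L²(B)` function is integrable and vanishes off a ball centred at
the origin. [folklore] -/
theorem integrable_indicator_ball {V : Type*} [NormedAddCommGroup V] [NormedSpace ℝ V]
    {x₀ : (EuclideanSpace ℝ (Fin 3))} {R : ℝ} {h : (EuclideanSpace ℝ (Fin 3)) → V} (hh : MemLp h 2 (volume.restrict (ball x₀ R))) :
    Integrable ((ball x₀ R).indicator h) volume ∧
      ∀ z, ‖x₀‖ + |R| < ‖z‖ → (ball x₀ R).indicator h z = 0 := by
  haveI : IsFiniteMeasure ((volume : Measure (EuclideanSpace ℝ (Fin 3))).restrict (ball x₀ R)) :=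
    isFiniteMeasure_restrict.2 measure_ball_lt_top.ne
  refine ⟨IntegrableOn.integrable_indicator (hh.integrable one_le_two) measurableSet_ball,
    fun z hz => indicator_of_notMem (fun hzB => ?_) _⟩
  rw [mem_ball, dist_eq_norm] at hzB
  have : ‖z‖ ≤ ‖z - x₀‖ + ‖x₀‖ := norm_le_norm_sub_add z x₀
  linarith [le_abs_self R]

/-! ### The mollified equation holds pointwise inside -/

/-- **`Δ(ψ ⋆ f̃) = div(ψ ⋆ F̃)` inside.** Let `f ∈ L²(B_R)`, `F ∈ L²(B_R)` satisfy the very weak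
equation `∫_{B_R} f Δφ = -∫_{B_R} ⟪F, ∇φ⟫` for `φ ∈ C_c^∞(B_R)`, and let `ψ` be a bump of outer
radius `δ`. Then at every `x` with `B̄(x, δ) ⊆ B_R`,
`Δ(ψ ⋆ f̃)(x) = Σⱼ ∂ⱼ(ψ ⋆ F̃)ⱼ(x)` (`f̃, F̃` the extensions by zero). [folklore] -/
theorem laplacian_mollified_eq {x₀ : (EuclideanSpace ℝ (Fin 3))} {R : ℝ} {f : (EuclideanSpace ℝ (Fin 3)) → ℝ} {F : (EuclideanSpace ℝ (Fin 3)) → (EuclideanSpace ℝ (Fin 3))}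
    (hf : MemLp f 2 (volume.restrict (ball x₀ R))) (hF : MemLp F 2 (volume.restrict (ball x₀ R)))
    (heq : ∀ φ : (EuclideanSpace ℝ (Fin 3)) → ℝ, IsTestFunctionOn (⟨ball x₀ R, isOpen_ball⟩ : Opens (EuclideanSpace ℝ (Fin 3))) φ →
      ∫ x in ball x₀ R, f x * (Δ φ) x = -∫ x in ball x₀ R, ⟪F x, gradient φ x⟫)
    (ψ : ContDiffBump (0 : (EuclideanSpace ℝ (Fin 3)))) {x : (EuclideanSpace ℝ (Fin 3))} (hx : closedBall x ψ.rOut ⊆ ball x₀ R) :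
    (Δ (ψ.normed volume ⋆[ContinuousLinearMap.lsmul ℝ ℝ, volume] (ball x₀ R).indicator f)) x =
      ∑ j, fderiv ℝ (fun y => (ψ.normed volume ⋆[ContinuousLinearMap.lsmul ℝ ℝ, volume]
        (ball x₀ R).indicator F) y j) x (EuclideanSpace.single j (1 : ℝ)) := by
  obtain ⟨hfi, hf0⟩ := integrable_indicator_ball hf
  obtain ⟨hFi, hF0⟩ := integrable_indicator_ball hF
  have hFji : ∀ j : Fin 3, Integrable (fun z => (ball x₀ R).indicator F z j) volume := fun j =>
    (EuclideanSpace.proj j : (EuclideanSpace ℝ (Fin 3)) →L[ℝ] ℝ).integrable_comp hFi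
  have hFj0 : ∀ (j : Fin 3) z, ‖x₀‖ + |R| < ‖z‖ → (ball x₀ R).indicator F z j = 0 := fun j z hz => by
    rw [hF0 z hz]; rfl
  have hψs : ContDiff ℝ (⊤ : ℕ∞) (ψ.normed volume) := ψ.contDiff_normed
  have hψ2 : ContDiff ℝ 2 (ψ.normed volume) := ψ.contDiff_normed
  have hψ1 : ContDiff ℝ 1 (ψ.normed volume) := ψ.contDiff_normed
  -- the mollifications as integrals against the data
  have hfe : (ψ.normed volume ⋆[ContinuousLinearMap.lsmul ℝ ℝ, volume] (ball x₀ R).indicator f) =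
      fun y => ∫ z, (ball x₀ R).indicator f z * ψ.normed volume (y - z) :=
    funext fun y => LaplaceDivFormMollified.normed_convolution_eq ψ _ y
  have hFe : ∀ j : Fin 3, (fun y => (ψ.normed volume ⋆[ContinuousLinearMap.lsmul ℝ ℝ, volume]
      (ball x₀ R).indicator F) y j) = fun y => ∫ z, (ball x₀ R).indicator F z j * ψ.normed volume (y - z) :=
    fun j => funext fun y => normed_convolution_apply_coord ψ hFi y j
  rw [hfe]
  simp_rw [hFe]
  -- the Laplacian falls on the bump
  rw [laplacian_integral_mul_comp_sub hfi hf0 hψ2 x]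
  -- the derivatives fall on the bump
  have hD : ∀ j : Fin 3, fderiv ℝ (fun y => ∫ z, (ball x₀ R).indicator F z j * ψ.normed volume (y - z)) x (EuclideanSpace.single j (1 : ℝ))
      = ∫ z, (ball x₀ R).indicator F z j * fderiv ℝ (ψ.normed volume) (x - z) (EuclideanSpace.single j (1 : ℝ)) := by
    intro j
    have h := fderiv_integral_smul_comp_sub_apply (hFji j) (hFj0 j) hψ1 x (EuclideanSpace.single j (1 : ℝ))
    simp only [smul_eq_mul] at h
    exact h
  simp_rw [hD]
  -- the very weak equation with the test function `ψ(x - ·)`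
  set φx : (EuclideanSpace ℝ (Fin 3)) → ℝ := fun z => ψ.normed volume (x - z) with hφx
  have hφt : IsTestFunctionOn (⟨ball x₀ R, isOpen_ball⟩ : Opens (EuclideanSpace ℝ (Fin 3))) φx :=
    isTestFunctionOn_normed_comp_sub (μ := volume) ψ hx
  have key := heq φx hφt
  have hΔφ : ∀ z, (Δ φx) z = (Δ (ψ.normed volume)) (x - z) := fun z =>
    laplacian_comp_const_sub (ψ.normed volume) x z
  have hdφ : ∀ z (j : Fin 3), fderiv ℝ φx z (EuclideanSpace.single j (1 : ℝ)) = -fderiv ℝ (ψ.normed volume) (x - z) (EuclideanSpace.single j (1 : ℝ)) := by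
    intro z j
    rw [hφx, fderiv_comp_const_sub (ψ.normed volume) x z]
    rfl
  -- left-hand side: `∫ f̃ Δψ(x - ·)`
  have hL : ∫ z, (ball x₀ R).indicator f z * (Δ (ψ.normed volume)) (x - z) =
      ∫ z in ball x₀ R, f z * (Δ φx) z := by
    rw [← integral_indicator measurableSet_ball]
    refine integral_congr_ae (Eventually.of_forall fun z => ?_)
    simp only [hΔφ]
    by_cases hz : z ∈ ball x₀ R
    · rw [indicator_of_mem hz, indicator_of_mem hz]
    · rw [indicator_of_notMem hz, indicator_of_notMem hz, zero_mul]
  -- right-hand side: `-∫ ⟪F, ∇ψ(x - ·)⟫ = Σⱼ ∫ F̃ⱼ ∂ⱼψ(x - ·)`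
  have hgrad : ∀ z, ⟪F z, gradient φx z⟫ = ∑ j, F z j * fderiv ℝ φx z (EuclideanSpace.single j (1 : ℝ)) := by
    intro z
    conv_lhs => rw [eq_sum_coord_smul_single (F z)]
    rw [sum_inner]
    refine Finset.sum_congr rfl fun j _ => ?_
    rw [real_inner_smul_left, HeatDivForm.real_inner_gradient_right]
  have hR : -∫ z in ball x₀ R, ⟪F z, gradient φx z⟫ =
      ∑ j, ∫ z, (ball x₀ R).indicator F z j * fderiv ℝ (ψ.normed volume) (x - z) (EuclideanSpace.single j (1 : ℝ)) := by
    simp_rw [hgrad, hdφ, mul_neg, Finset.sum_neg_distrib, integral_neg, neg_neg]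
    have hint : ∀ j : Fin 3, Integrable (fun z => F z j * fderiv ℝ (ψ.normed volume) (x - z) (EuclideanSpace.single j (1 : ℝ)))
        (volume.restrict (ball x₀ R)) := by
      intro j
      have hc : Continuous fun z => fderiv ℝ (ψ.normed volume) (x - z) (EuclideanSpace.single j (1 : ℝ)) :=
        ((hψ1.continuous_fderiv one_ne_zero).comp (continuous_const.sub continuous_id)).clm_apply
          continuous_const
      have hc0 : Continuous fun y => fderiv ℝ (ψ.normed volume) y (EuclideanSpace.single j (1 : ℝ)) :=
        (hψ1.continuous_fderiv one_ne_zero).clm_apply continuous_const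
      obtain ⟨C, hC⟩ := hc0.bounded_above_of_compact_support
        ((ψ.hasCompactSupport_normed (μ := volume)).fderiv_apply (𝕜 := ℝ) (EuclideanSpace.single j (1 : ℝ)))
      haveI : IsFiniteMeasure ((volume : Measure (EuclideanSpace ℝ (Fin 3))).restrict (ball x₀ R)) :=
        isFiniteMeasure_restrict.2 measure_ball_lt_top.ne
      have hFj : Integrable (fun z => F z j) (volume.restrict (ball x₀ R)) :=
        (EuclideanSpace.proj j : (EuclideanSpace ℝ (Fin 3)) →L[ℝ] ℝ).integrable_comp (hF.integrable one_le_two)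
      refine (hFj.norm.mul_const C).mono' (hFj.1.mul hc.aestronglyMeasurable) ?_
      refine Eventually.of_forall fun z => ?_
      rw [norm_mul]
      exact mul_le_mul_of_nonneg_left (hC (x - z)) (norm_nonneg _)
    rw [integral_finsetSum _ fun j _ => hint j]
    refine Finset.sum_congr rfl fun j _ => ?_
    rw [← integral_indicator measurableSet_ball]
    refine integral_congr_ae (Eventually.of_forall fun z => ?_)
    show (ball x₀ R).indicator (fun z => F z j * fderiv ℝ (ψ.normed volume) (x - z) (EuclideanSpace.single j (1 : ℝ))) z =
      (ball x₀ R).indicator F z j * fderiv ℝ (ψ.normed volume) (x - z) (EuclideanSpace.single j (1 : ℝ))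
    by_cases hz : z ∈ ball x₀ R
    · rw [indicator_of_mem hz, indicator_of_mem hz]
    · rw [indicator_of_notMem hz, indicator_of_notMem hz]
      simp
  rw [hL, key, hR]

/-! ### Smooth solutions of `Δw = Σⱼ ∂ⱼGⱼ` are weak solutions in the gradient form -/

/-- `L(∇φ(x)) = Σⱼ ∂ⱼφ(x) L(eⱼ)` for a linear functional `L` on `ℝ³`. [folklore] -/
theorem clm_gradient_eq_sum (L : (EuclideanSpace ℝ (Fin 3)) →L[ℝ] ℝ) (φ : (EuclideanSpace ℝ (Fin 3)) → ℝ) (x : (EuclideanSpace ℝ (Fin 3))) :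
    L (gradient φ x) = ∑ j, fderiv ℝ φ x (EuclideanSpace.single j (1 : ℝ)) * L (EuclideanSpace.single j (1 : ℝ)) := by
  conv_lhs => rw [eq_sum_coord_smul_single (gradient φ x)]
  rw [map_sum]
  refine Finset.sum_congr rfl fun j _ => ?_
  rw [map_smul, smul_eq_mul, coord_eq_inner_single, real_inner_comm,
    HeatDivForm.real_inner_gradient_right]

/-- **A smooth solution of `Δw = Σⱼ ∂ⱼGⱼ` on an open set is a weak solution there, in the gradient
form**: `∫ Dw(∇φ) = ∫ ⟪G, ∇φ⟫` for every test function `φ` supported in the set (two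
integrations by parts without boundary). [folklore] -/
theorem integral_fderiv_gradient_eq_of_laplacian_eq {U : Set (EuclideanSpace ℝ (Fin 3))} {w : (EuclideanSpace ℝ (Fin 3)) → ℝ} {G : (EuclideanSpace ℝ (Fin 3)) → (EuclideanSpace ℝ (Fin 3))}
    (hw : ContDiff ℝ 2 w) (hG : ∀ j : Fin 3, ContDiff ℝ 1 fun y => G y j)
    (hΔ : ∀ x ∈ U, (Δ w) x = ∑ j, fderiv ℝ (fun y => G y j) x (EuclideanSpace.single j (1 : ℝ)))
    {φ : (EuclideanSpace ℝ (Fin 3)) → ℝ} (hφ : ContDiff ℝ (⊤ : ℕ∞) φ) (hφc : HasCompactSupport φ) (hφU : tsupport φ ⊆ U) :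
    ∫ x, fderiv ℝ w x (gradient φ x) = ∫ x, ⟪G x, gradient φ x⟫ := by
  set b : OrthonormalBasis (Fin 3) ℝ (EuclideanSpace ℝ (Fin 3)) := EuclideanSpace.basisFun (Fin 3) ℝ with hb
  have hbi : ∀ i, b i = EuclideanSpace.single i (1 : ℝ) := fun i => by rw [hb, EuclideanSpace.basisFun_apply]
  have hφ1 : ContDiff ℝ 1 φ := hφ.of_le (by exact_mod_cast le_top)
  have hφd : Differentiable ℝ φ := hφ1.differentiable one_ne_zero
  have hwd : Differentiable ℝ w := hw.differentiable (by norm_num)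
  have hφ0 : ∀ x ∉ tsupport φ, φ x = 0 := fun x hx => image_eq_zero_of_notMem_tsupport hx
  have hdφ0 : ∀ x ∉ tsupport φ, ∀ v, fderiv ℝ φ x v = 0 := fun x hx v => by
    rw [fderiv_of_notMem_tsupport ℝ hx]; rfl
  -- Green without boundary: `∫ (Δw) φ + Σᵢ ∫ ∂ᵢw ∂ᵢφ = 0`
  have hGreen := integral_inner_laplacian_add_eq_zero (F' := ℝ) b hw hφ1 (Or.inr hφc)
  have e1 : ∫ x, fderiv ℝ w x (gradient φ x) = ∑ i, ∫ x, ⟪fderiv ℝ w x (b i), fderiv ℝ φ x (b i)⟫ := by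
    have hint : ∀ i, Integrable (fun x => ⟪fderiv ℝ w x (b i), fderiv ℝ φ x (b i)⟫) volume := by
      intro i
      have hc : Continuous fun x => ⟪fderiv ℝ w x (b i), fderiv ℝ φ x (b i)⟫ :=
        ((hw.continuous_fderiv (by norm_num)).clm_apply continuous_const).inner
          ((hφ1.continuous_fderiv one_ne_zero).clm_apply continuous_const)
      refine hc.integrable_of_hasCompactSupport (HasCompactSupport.intro hφc fun x hx => ?_)
      rw [hdφ0 x hx]; simp
    rw [← integral_finsetSum _ fun i _ => hint i]
    refine integral_congr_ae (Eventually.of_forall fun x => ?_)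
    show fderiv ℝ w x (gradient φ x) = ∑ i, ⟪fderiv ℝ w x (b i), fderiv ℝ φ x (b i)⟫
    rw [clm_gradient_eq_sum]
    refine Finset.sum_congr rfl fun i _ => ?_
    rw [hbi]
    simp [mul_comm]
  have e2 : ∫ x, ⟪(Δ w) x, φ x⟫ = ∫ x, (∑ j, fderiv ℝ (fun y => G y j) x (EuclideanSpace.single j (1 : ℝ))) * φ x := by
    refine integral_congr_ae (Eventually.of_forall fun x => ?_)
    show ⟪(Δ w) x, φ x⟫ = (∑ j, fderiv ℝ (fun y => G y j) x (EuclideanSpace.single j (1 : ℝ))) * φ x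
    by_cases hx : x ∈ tsupport φ
    · rw [← hΔ x (hφU hx)]
      simp [mul_comm]
    · rw [hφ0 x hx]; simp
  -- `∫ (∂ⱼGⱼ) φ = -∫ Gⱼ ∂ⱼφ`
  have e3 : ∀ j : Fin 3, ∫ x, fderiv ℝ (fun y => G y j) x (EuclideanSpace.single j (1 : ℝ)) * φ x = -∫ x, G x j * fderiv ℝ φ x (EuclideanSpace.single j (1 : ℝ)) := by
    intro j
    have hprod : ContDiff ℝ 1 fun y => G y j * φ y := (hG j).mul hφ1
    have hprodc : HasCompactSupport fun y => G y j * φ y := hφc.mul_left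
    have h0 := integral_fderiv_apply_eq_zero hprod hprodc (EuclideanSpace.single j (1 : ℝ))
    have hpt : ∀ x, fderiv ℝ (fun y => G y j * φ y) x (EuclideanSpace.single j (1 : ℝ)) =
        fderiv ℝ (fun y => G y j) x (EuclideanSpace.single j (1 : ℝ)) * φ x + G x j * fderiv ℝ φ x (EuclideanSpace.single j (1 : ℝ)) := by
      intro x
      rw [fderiv_fun_mul (((hG j).differentiable one_ne_zero) x) (hφd x)]
      simp only [_root_.add_apply, _root_.smul_apply, smul_eq_mul]
      ring
    simp_rw [hpt] at h0
    have hi1 : Integrable (fun x => fderiv ℝ (fun y => G y j) x (EuclideanSpace.single j (1 : ℝ)) * φ x) volume := by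
      have hc : Continuous fun x => fderiv ℝ (fun y => G y j) x (EuclideanSpace.single j (1 : ℝ)) * φ x :=
        (((hG j).continuous_fderiv one_ne_zero).clm_apply continuous_const).mul hφ.continuous
      exact hc.integrable_of_hasCompactSupport hφc.mul_left
    have hi2 : Integrable (fun x => G x j * fderiv ℝ φ x (EuclideanSpace.single j (1 : ℝ))) volume := by
      have hc : Continuous fun x => G x j * fderiv ℝ φ x (EuclideanSpace.single j (1 : ℝ)) :=
        (hG j).continuous.mul ((hφ1.continuous_fderiv one_ne_zero).clm_apply continuous_const)
      refine hc.integrable_of_hasCompactSupport (HasCompactSupport.intro hφc fun x hx => ?_)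
      rw [hdφ0 x hx]; simp
    rw [integral_add hi1 hi2] at h0
    linarith
  have e4 : ∫ x, (∑ j, fderiv ℝ (fun y => G y j) x (EuclideanSpace.single j (1 : ℝ))) * φ x =
      -∑ j, ∫ x, G x j * fderiv ℝ φ x (EuclideanSpace.single j (1 : ℝ)) := by
    have hint : ∀ j : Fin 3, Integrable (fun x => fderiv ℝ (fun y => G y j) x (EuclideanSpace.single j (1 : ℝ)) * φ x) volume := by
      intro j
      have hc : Continuous fun x => fderiv ℝ (fun y => G y j) x (EuclideanSpace.single j (1 : ℝ)) * φ x :=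
        (((hG j).continuous_fderiv one_ne_zero).clm_apply continuous_const).mul hφ.continuous
      exact hc.integrable_of_hasCompactSupport hφc.mul_left
    simp_rw [Finset.sum_mul]
    rw [integral_finsetSum _ fun j _ => hint j, ← Finset.sum_neg_distrib]
    exact Finset.sum_congr rfl fun j _ => e3 j
  have e5 : ∫ x, ⟪G x, gradient φ x⟫ = ∑ j, ∫ x, G x j * fderiv ℝ φ x (EuclideanSpace.single j (1 : ℝ)) := by
    have hint : ∀ j : Fin 3, Integrable (fun x => G x j * fderiv ℝ φ x (EuclideanSpace.single j (1 : ℝ))) volume := by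
      intro j
      have hc : Continuous fun x => G x j * fderiv ℝ φ x (EuclideanSpace.single j (1 : ℝ)) :=
        (hG j).continuous.mul ((hφ1.continuous_fderiv one_ne_zero).clm_apply continuous_const)
      refine hc.integrable_of_hasCompactSupport (HasCompactSupport.intro hφc fun x hx => ?_)
      rw [hdφ0 x hx]; simp
    rw [← integral_finsetSum _ fun j _ => hint j]
    exact integral_congr_ae (Eventually.of_forall fun x => inner_gradient_eq_sum _ _ _)
  -- assemble: `Σᵢ ∫ ∂ᵢw ∂ᵢφ = -∫ Δw φ = Σⱼ ∫ Gⱼ ∂ⱼφ`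
  have e6 : ∑ i, ∫ x, ⟪fderiv ℝ w x (b i), fderiv ℝ φ x (b i)⟫ = -∫ x, ⟪(Δ w) x, φ x⟫ := by
    linarith
  rw [e1, e6, e2, e4, neg_neg, e5]

/-! ### The main estimate -/

set_option maxHeartbeats 1600000 in
/-- **Very weak `L²` solutions of `Δf = div F` are `W^{1,2}` inside, with the bound** (module
docstring). For `0 < ρ < R` there is `C = C(ρ, R)` such that for every centre `x₀` and every
`f ∈ L²(B(x₀, R))`, `F ∈ L²(B(x₀, R); ℝ³)` with `∫_{B_R} f Δφ = -∫_{B_R} ⟪F, ∇φ⟫` for all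
`φ ∈ C_c^∞(B(x₀, R))`: `f` has a weak derivative `g ∈ L²(B(x₀, ρ))` on `B(x₀, ρ)` with
`‖g‖_{L²(B_ρ)} ≤ C (‖f‖_{L²(B_R)} + ‖F‖_{L²(B_R)})`, and the weak equation holds on `B(x₀, ρ)` in
the gradient form `∫_{B_ρ} g(∇φ) = ∫_{B_ρ} ⟪F, ∇φ⟫`.
[cite: GilbargTrudinger2001, §7.2–7.3 with the proof of Thm. 8.17 / (8.38)] -/
theorem exists_weakGrad_of_veryWeak {ρ R : ℝ} (h0 : 0 < ρ) (h1 : ρ < R) :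
    ∃ C : ℝ≥0, ∀ (x₀ : (EuclideanSpace ℝ (Fin 3))) (f : (EuclideanSpace ℝ (Fin 3)) → ℝ) (F : (EuclideanSpace ℝ (Fin 3)) → (EuclideanSpace ℝ (Fin 3))),
      MemLp f 2 (volume.restrict (ball x₀ R)) → MemLp F 2 (volume.restrict (ball x₀ R)) →
      (∀ φ : (EuclideanSpace ℝ (Fin 3)) → ℝ, IsTestFunctionOn (⟨ball x₀ R, isOpen_ball⟩ : Opens (EuclideanSpace ℝ (Fin 3))) φ →
        ∫ x in ball x₀ R, f x * (Δ φ) x = -∫ x in ball x₀ R, ⟪F x, gradient φ x⟫) →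
      ∃ g : (EuclideanSpace ℝ (Fin 3)) → (EuclideanSpace ℝ (Fin 3)) →L[ℝ] ℝ,
        HasWeakFDerivOn (⟨ball x₀ ρ, isOpen_ball⟩ : Opens (EuclideanSpace ℝ (Fin 3))) volume f g ∧
        MemLp g 2 (volume.restrict (ball x₀ ρ)) ∧
        eLpNorm g 2 (volume.restrict (ball x₀ ρ)) ≤
          C * (eLpNorm f 2 (volume.restrict (ball x₀ R)) + eLpNorm F 2 (volume.restrict (ball x₀ R))) ∧
        ∀ φ : (EuclideanSpace ℝ (Fin 3)) → ℝ, IsTestFunctionOn (⟨ball x₀ ρ, isOpen_ball⟩ : Opens (EuclideanSpace ℝ (Fin 3))) φ →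
          ∫ x in ball x₀ ρ, g x (gradient φ x) = ∫ x in ball x₀ ρ, ⟪F x, gradient φ x⟫ := by
  -- radii and the centre-free cut-off constant
  set R₁ : ℝ := (ρ + R) / 2 with hR₁
  set c : ℝ := (ρ + R₁) / 2 with hc
  have hρc : ρ < c := by rw [hc, hR₁]; linarith
  have hcR₁ : c < R₁ := by rw [hc, hR₁]; linarith
  have hR₁R : R₁ < R := by rw [hR₁]; linarith
  have hd : 0 < R - R₁ := by linarith
  obtain ⟨K, hK0, hK⟩ := exists_bound_fderiv_radialCutoff (r₀ := ρ) (r₁ := c) h0.le hρc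
  set A : ℝ≥0∞ := ENNReal.ofReal (Real.sqrt 10 * K) + 2 with hA
  have hAtop : A ≠ ⊤ := by rw [hA]; exact ENNReal.add_ne_top.2 ⟨ENNReal.ofReal_ne_top, by norm_num⟩
  refine ⟨(3 * A).toNNReal, fun x₀ f F hf hF heq => ?_⟩
  have hCeq : (((3 * A).toNNReal : ℝ≥0) : ℝ≥0∞) = 3 * A :=
    ENNReal.coe_toNNReal (ENNReal.mul_ne_top (by norm_num) hAtop)
  -- names and basic facts
  set Nf : ℝ≥0∞ := eLpNorm f 2 (volume.restrict (ball x₀ R)) with hNf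
  set NF : ℝ≥0∞ := eLpNorm F 2 (volume.restrict (ball x₀ R)) with hNF
  have hNftop : Nf ≠ ⊤ := hf.eLpNorm_ne_top
  have hNFtop : NF ≠ ⊤ := hF.eLpNorm_ne_top
  set M : ℝ≥0∞ := A * (Nf + NF) with hM
  have hMtop : M ≠ ⊤ := ENNReal.mul_ne_top hAtop (ENNReal.add_ne_top.2 ⟨hNftop, hNFtop⟩)
  set ft : (EuclideanSpace ℝ (Fin 3)) → ℝ := (ball x₀ R).indicator f with hft
  set Ft : (EuclideanSpace ℝ (Fin 3)) → (EuclideanSpace ℝ (Fin 3)) := (ball x₀ R).indicator F with hFt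
  have hft2 : MemLp ft 2 volume := (memLp_indicator_iff_restrict measurableSet_ball).2 hf
  have hFt2 : MemLp Ft 2 volume := (memLp_indicator_iff_restrict measurableSet_ball).2 hF
  have hftN : eLpNorm ft 2 volume = Nf := eLpNorm_indicator_eq_eLpNorm_restrict measurableSet_ball
  have hFtN : eLpNorm Ft 2 volume = NF := eLpNorm_indicator_eq_eLpNorm_restrict measurableSet_ball
  have hftl : LocallyIntegrable ft volume := hft2.locallyIntegrable one_le_two
  have hFtl : LocallyIntegrable Ft volume := hFt2.locallyIntegrable one_le_two
  -- a mollifier sequence with radii below `R - R₁`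
  obtain ⟨ψ₀, hψ₀lim, -⟩ := exists_contDiffBump_seq (E := (EuclideanSpace ℝ (Fin 3)))
  obtain ⟨N, hN⟩ := Filter.eventually_atTop.1 (hψ₀lim.eventually (gt_mem_nhds hd))
  set ψ : ℕ → ContDiffBump (0 : (EuclideanSpace ℝ (Fin 3))) := fun n => ψ₀ (n + N) with hψ
  have hψlim : Tendsto (fun n => (ψ n).rOut) atTop (𝓝 0) := hψ₀lim.comp (tendsto_add_atTop_nat N)
  have hψd : ∀ n, (ψ n).rOut < R - R₁ := fun n => hN (n + N) (Nat.le_add_left N n)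
  -- the mollifications
  set fn : ℕ → (EuclideanSpace ℝ (Fin 3)) → ℝ := fun n => (ψ n).normed volume ⋆[ContinuousLinearMap.lsmul ℝ ℝ, volume] ft
    with hfn
  set Fn : ℕ → (EuclideanSpace ℝ (Fin 3)) → (EuclideanSpace ℝ (Fin 3)) := fun n => (ψ n).normed volume ⋆[ContinuousLinearMap.lsmul ℝ ℝ, volume] Ft
    with hFn
  have hfns : ∀ n, ContDiff ℝ 2 (fn n) := fun n =>
    ((ψ n).hasCompactSupport_normed (μ := volume)).contDiff_convolution_left _
      ((ψ n).contDiff_normed (n := 2)) hftl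
  have hFns : ∀ n, ContDiff ℝ 1 (Fn n) := fun n =>
    ((ψ n).hasCompactSupport_normed (μ := volume)).contDiff_convolution_left _
      ((ψ n).contDiff_normed (n := 1)) hFtl
  have hFnjs : ∀ n (j : Fin 3), ContDiff ℝ 1 fun y => Fn n y j := fun n j =>
    (EuclideanSpace.proj j : (EuclideanSpace ℝ (Fin 3)) →L[ℝ] ℝ).contDiff.comp (hFns n)
  have hfn2 : ∀ n, MemLp (fn n) 2 volume := fun n => memLp_normed_convolution (ψ n) hft2 one_le_two
  have hFn2 : ∀ n, MemLp (Fn n) 2 volume := fun n => memLp_normed_convolution (ψ n) hFt2 one_le_two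
  have hfnN : ∀ n, eLpNorm (fn n) 2 volume ≤ Nf := fun n => by
    rw [← hftN]; exact eLpNorm_normed_convolution_le (ψ n) hft2.1 one_le_two
  have hFnN : ∀ n, eLpNorm (Fn n) 2 volume ≤ NF := fun n => by
    rw [← hFtN]; exact eLpNorm_normed_convolution_le (ψ n) hFt2.1 one_le_two
  -- the mollified equation on `B(x₀, R₁)`
  have hΔn : ∀ n, ∀ x ∈ ball x₀ R₁, (Δ (fn n)) x = ∑ j, fderiv ℝ (fun y => Fn n y j) x (EuclideanSpace.single j (1 : ℝ)) := by
    intro n x hx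
    refine laplacian_mollified_eq hf hF heq (ψ n) fun y hy => ?_
    rw [mem_ball]
    rw [mem_closedBall] at hy
    rw [mem_ball] at hx
    calc dist y x₀ ≤ dist y x + dist x x₀ := dist_triangle _ _ _
      _ < (R - R₁) + R₁ := add_lt_add_of_le_of_lt (hy.trans (hψd n).le) hx
      _ = R := by ring
  -- the weak gradient-form equation for the mollifications on `B(x₀, R₁)`
  have hweakn : ∀ n (φ : (EuclideanSpace ℝ (Fin 3)) → ℝ), IsTestFunctionOn (⟨ball x₀ R₁, isOpen_ball⟩ : Opens (EuclideanSpace ℝ (Fin 3))) φ →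
      ∫ x in ball x₀ R₁, fderiv ℝ (fn n) x (gradient φ x) = ∫ x in ball x₀ R₁, ⟪Fn n x, gradient φ x⟫ := by
    intro n φ hφ
    have hg0 : ∀ x ∉ ball x₀ R₁, gradient φ x = 0 := fun x hx =>
      gradient_eq_zero_of_notMem_tsupport fun h => hx (hφ.tsupport_subset h)
    rw [setIntegral_eq_integral_of_forall_compl_eq_zero fun x hx => by rw [hg0 x hx]; simp,
      setIntegral_eq_integral_of_forall_compl_eq_zero fun x hx => by rw [hg0 x hx]; simp]
    exact integral_fderiv_gradient_eq_of_laplacian_eq (hfns n) (hFnjs n) (hΔn n) hφ.contDiff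
      hφ.hasCompactSupport hφ.tsupport_subset
  -- Caccioppoli with the centre-free cut-off: `‖∇fₙ‖_{L²(B_ρ)} ≤ M`
  have hgradn : ∀ n, eLpNorm (fderiv ℝ (fn n)) 2 (volume.restrict (ball x₀ ρ)) ≤ M := by
    intro n
    have hw : HasWeakFDerivOn (⟨ball x₀ R₁, isOpen_ball⟩ : Opens (EuclideanSpace ℝ (Fin 3))) volume (fn n) (fderiv ℝ (fn n)) :=
      HasWeakFDerivOn.of_contDiff_holds _ volume ((hfns n).of_le one_le_two)
    have hw2 : MemLp (fn n) 2 (volume.restrict (ball x₀ R₁)) := (hfn2 n).restrict _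
    have hg2 : MemLp (fderiv ℝ (fn n)) 2 (volume.restrict (ball x₀ R₁)) := by
      have hcont : Continuous (fderiv ℝ (fn n)) := (hfns n).continuous_fderiv (by norm_num)
      obtain ⟨C₀, hC₀⟩ := (isCompact_closedBall x₀ R₁).exists_bound_of_continuousOn hcont.continuousOn
      haveI : IsFiniteMeasure ((volume : Measure (EuclideanSpace ℝ (Fin 3))).restrict (ball x₀ R₁)) :=
        isFiniteMeasure_restrict.2 measure_ball_lt_top.ne
      exact (memLp_top_of_bound hcont.aestronglyMeasurable C₀
        ((ae_restrict_iff' measurableSet_ball).2 (Eventually.of_forall fun x hx =>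
          hC₀ x (ball_subset_closedBall hx)))).mono_exponent le_top
    have hF2 : MemLp (Fn n) 2 (volume.restrict (ball x₀ R₁)) := (hFn2 n).restrict _
    have h := eLpNorm_weakGrad_le hw hw2 hg2 hF2 (hweakn n) h0 hρc hcR₁ hK
    refine h.trans ?_
    rw [hM, hA, add_mul]
    refine add_le_add ?_ ?_
    · exact mul_le_mul_of_nonneg_left ((eLpNorm_restrict_le _ _ _ _).trans ((hfnN n).trans le_self_add)) bot_le
    · exact mul_le_mul_of_nonneg_left ((eLpNorm_restrict_le _ _ _ _).trans ((hFnN n).trans le_add_self)) bot_le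
  -- `L²` convergence of the mollifications
  have hconv : Tendsto (fun n => eLpNorm (fn n - ft) 2 volume) atTop (𝓝 0) :=
    tendsto_eLpNorm_normed_convolution_sub_self (μ := volume) hψlim one_le_two ENNReal.ofNat_ne_top hft2
  have hconv' : Tendsto (fun n => (eLpNorm (fn n - ft) 2 volume).toReal) atTop (𝓝 0) := by
    have h := (ENNReal.tendsto_toReal ENNReal.zero_ne_top).comp hconv
    rwa [ENNReal.toReal_zero] at h
  -- finite measure on the small ball and integrability of `f` there
  haveI hfinρ : IsFiniteMeasure ((volume : Measure (EuclideanSpace ℝ (Fin 3))).restrict (ball x₀ ρ)) :=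
    isFiniteMeasure_restrict.2 measure_ball_lt_top.ne
  have hρR : ball x₀ ρ ⊆ ball x₀ R := ball_subset_ball h1.le
  have hfρ2 : MemLp f 2 (volume.restrict (ball x₀ ρ)) := hf.mono_measure (Measure.restrict_mono hρR le_rfl)
  have hfρi : Integrable f (volume.restrict (ball x₀ ρ)) := hfρ2.integrable one_le_two
  -- **the bound on the pairings** `|∫_{B_ρ} (∂ᵥφ) f| ≤ ‖v‖ M ‖φ‖_{L²(B_ρ)}`
  have hpair : ∀ (v : (EuclideanSpace ℝ (Fin 3))) (φ : (EuclideanSpace ℝ (Fin 3)) → ℝ), IsTestFunctionOn (⟨ball x₀ ρ, isOpen_ball⟩ : Opens (EuclideanSpace ℝ (Fin 3))) φ →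
      |∫ x in ball x₀ ρ, fderiv ℝ φ x v * f x| ≤
        ‖v‖ * M.toReal * (eLpNorm φ 2 (volume.restrict (ball x₀ ρ))).toReal := by
    intro v φ hφ
    have hφ1 : ContDiff ℝ 1 φ := hφ.contDiff.of_le (by exact_mod_cast le_top)
    have hφd : Differentiable ℝ φ := hφ1.differentiable one_ne_zero
    set D : (EuclideanSpace ℝ (Fin 3)) → ℝ := fun x => fderiv ℝ φ x v with hD
    have hDc : Continuous D := (hφ1.continuous_fderiv one_ne_zero).clm_apply continuous_const
    have hDsupp : ∀ x ∉ ball x₀ ρ, D x = 0 := fun x hx => by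
      rw [hD]; simp only
      rw [fderiv_of_notMem_tsupport ℝ (fun h => hx (hφ.tsupport_subset h))]; rfl
    have hDcs : HasCompactSupport D := hφ.hasCompactSupport.fderiv_apply (𝕜 := ℝ) v
    have hD2 : MemLp D 2 volume := hDc.memLp_of_hasCompactSupport hDcs
    -- the pairings with the mollifications and with `f`
    have hTn_int : ∀ n, Integrable (fun x => D x * fn n x) volume := fun n =>
      ((hfn2 n).integrable_mul hD2).congr (Eventually.of_forall fun x => by simp [mul_comm])
    have hT_int : Integrable (fun x => D x * ft x) volume :=
      (hft2.integrable_mul hD2).congr (Eventually.of_forall fun x => by simp [mul_comm])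
    have hTeq : ∫ x in ball x₀ ρ, D x * f x = ∫ x, D x * ft x := by
      rw [← integral_indicator measurableSet_ball]
      refine integral_congr_ae (Eventually.of_forall fun x => ?_)
      show (ball x₀ ρ).indicator (fun x => D x * f x) x = D x * ft x
      by_cases hx : x ∈ ball x₀ ρ
      · rw [indicator_of_mem hx, hft, indicator_of_mem (hρR hx)]
      · rw [indicator_of_notMem hx, hDsupp x hx, zero_mul]
    -- (a) convergence of the pairings
    have hlim : Tendsto (fun n => ∫ x, D x * fn n x) atTop (𝓝 (∫ x, D x * ft x)) := by
      rw [tendsto_iff_norm_sub_tendsto_zero]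
      have hbound : ∀ n, ‖(∫ x, D x * fn n x) - ∫ x, D x * ft x‖ ≤
          (eLpNorm D 2 volume).toReal * (eLpNorm (fn n - ft) 2 volume).toReal := by
        intro n
        rw [← integral_sub (hTn_int n) hT_int]
        have h1 : ∫ x, (D x * fn n x - D x * ft x) = ∫ x, D x * (fn n - ft) x :=
          integral_congr_ae (Eventually.of_forall fun x => by simp [mul_sub])
        rw [h1, Real.norm_eq_abs]
        have hsub2 : MemLp (fn n - ft) 2 volume := (hfn2 n).sub hft2
        calc |∫ x, D x * (fn n - ft) x| ≤ ∫ x, ‖D x‖ * ‖(fn n - ft) x‖ := by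
              refine (abs_integral_le_integral_abs).trans (le_of_eq (integral_congr_ae
                (Eventually.of_forall fun x => ?_)))
              simp only [abs_mul, Real.norm_eq_abs]
          _ ≤ Real.sqrt (∫ x, ‖D x‖ ^ 2) * Real.sqrt (∫ x, ‖(fn n - ft) x‖ ^ 2) :=
              integral_norm_mul_norm_le_sqrt_mul_sqrt hD2 hsub2
          _ = (eLpNorm D 2 volume).toReal * (eLpNorm (fn n - ft) 2 volume).toReal := by
              rw [HeatDivForm.toReal_eLpNorm_two_eq_sqrt hD2, HeatDivForm.toReal_eLpNorm_two_eq_sqrt hsub2]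
      refine squeeze_zero (fun n => norm_nonneg _) hbound ?_
      simpa using hconv'.const_mul (eLpNorm D 2 volume).toReal
    -- (b) integration by parts against the smooth mollification, and (c) the uniform bound
    have hTn_bound : ∀ n, |∫ x, D x * fn n x| ≤
        ‖v‖ * M.toReal * (eLpNorm φ 2 (volume.restrict (ball x₀ ρ))).toReal := by
      intro n
      have hfn1 : ContDiff ℝ 1 (fn n) := (hfns n).of_le one_le_two
      have hfnd : Differentiable ℝ (fn n) := hfn1.differentiable one_ne_zero
      -- `∫ ∂ᵥφ fₙ = -∫ φ ∂ᵥfₙ`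
      have hprod : ContDiff ℝ 1 fun y => φ y * fn n y := hφ1.mul hfn1
      have hprodc : HasCompactSupport fun y => φ y * fn n y := hφ.hasCompactSupport.mul_right
      have h0 := integral_fderiv_apply_eq_zero hprod hprodc v
      have hpt : ∀ x, fderiv ℝ (fun y => φ y * fn n y) x v = D x * fn n x + φ x * fderiv ℝ (fn n) x v := by
        intro x
        rw [fderiv_fun_mul (hφd x) (hfnd x)]
        simp only [_root_.add_apply, _root_.smul_apply, smul_eq_mul, hD]
        ring
      simp_rw [hpt] at h0
      have hEc : Continuous fun x => φ x * fderiv ℝ (fn n) x v :=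
        hφ.contDiff.continuous.mul (((hfns n).continuous_fderiv (by norm_num)).clm_apply continuous_const)
      have hEcs : HasCompactSupport fun x => φ x * fderiv ℝ (fn n) x v := hφ.hasCompactSupport.mul_right
      have hE_int : Integrable (fun x => φ x * fderiv ℝ (fn n) x v) volume :=
        hEc.integrable_of_hasCompactSupport hEcs
      rw [integral_add (hTn_int n) hE_int] at h0
      have hIBP : ∫ x, D x * fn n x = -∫ x, φ x * fderiv ℝ (fn n) x v := by linarith
      rw [hIBP, abs_neg]
      -- pass to the small ball and use Cauchy–Schwarz there
      have hφ0 : ∀ x ∉ ball x₀ ρ, φ x = 0 := fun x hx =>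
        image_eq_zero_of_notMem_tsupport fun h => hx (hφ.tsupport_subset h)
      rw [← setIntegral_eq_integral_of_forall_compl_eq_zero (s := ball x₀ ρ)
        (fun x hx => by rw [hφ0 x hx, zero_mul])]
      have hφ2 : MemLp φ 2 (volume.restrict (ball x₀ ρ)) :=
        (hφ.contDiff.continuous.memLp_of_hasCompactSupport hφ.hasCompactSupport).restrict _
      have hEv2 : MemLp (fun x => fderiv ℝ (fn n) x v) 2 (volume.restrict (ball x₀ ρ)) := by
        have hc : Continuous fun x => fderiv ℝ (fn n) x v :=
          ((hfns n).continuous_fderiv (by norm_num)).clm_apply continuous_const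
        obtain ⟨C₀, hC₀⟩ := (isCompact_closedBall x₀ ρ).exists_bound_of_continuousOn hc.continuousOn
        exact (memLp_top_of_bound hc.aestronglyMeasurable C₀
          ((ae_restrict_iff' measurableSet_ball).2 (Eventually.of_forall fun x hx =>
            hC₀ x (ball_subset_closedBall hx)))).mono_exponent le_top
      have hCS := integral_norm_mul_norm_le_sqrt_mul_sqrt hφ2 hEv2
      have hgradv : eLpNorm (fun x => fderiv ℝ (fn n) x v) 2 (volume.restrict (ball x₀ ρ)) ≤
          ENNReal.ofReal ‖v‖ * M := by
        refine (HeatDivForm.eLpNorm_le_ofReal_mul_of_le (norm_nonneg v) (fun x => ?_) 2).trans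
          (mul_le_mul_of_nonneg_left (hgradn n) bot_le)
        rw [mul_comm]; exact ContinuousLinearMap.le_opNorm _ _
      have hgradv' : Real.sqrt (∫ x in ball x₀ ρ, ‖fderiv ℝ (fn n) x v‖ ^ 2) ≤ ‖v‖ * M.toReal := by
        rw [← HeatDivForm.toReal_eLpNorm_two_eq_sqrt hEv2]
        have hfin : ENNReal.ofReal ‖v‖ * M ≠ ⊤ := ENNReal.mul_ne_top ENNReal.ofReal_ne_top hMtop
        refine (ENNReal.toReal_mono hfin hgradv).trans (le_of_eq ?_)
        rw [ENNReal.toReal_mul, ENNReal.toReal_ofReal (norm_nonneg _)]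
      calc |∫ x in ball x₀ ρ, φ x * fderiv ℝ (fn n) x v|
          ≤ ∫ x in ball x₀ ρ, ‖φ x‖ * ‖fderiv ℝ (fn n) x v‖ := by
            refine (abs_integral_le_integral_abs).trans (le_of_eq (integral_congr_ae
              (Eventually.of_forall fun x => ?_)))
            simp only [abs_mul, Real.norm_eq_abs]
        _ ≤ Real.sqrt (∫ x in ball x₀ ρ, ‖φ x‖ ^ 2) *
            Real.sqrt (∫ x in ball x₀ ρ, ‖fderiv ℝ (fn n) x v‖ ^ 2) := hCS
        _ ≤ (eLpNorm φ 2 (volume.restrict (ball x₀ ρ))).toReal * (‖v‖ * M.toReal) := by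
            rw [← HeatDivForm.toReal_eLpNorm_two_eq_sqrt hφ2]
            exact mul_le_mul_of_nonneg_left hgradv' ENNReal.toReal_nonneg
        _ = ‖v‖ * M.toReal * (eLpNorm φ 2 (volume.restrict (ball x₀ ρ))).toReal := by ring
    -- limit
    rw [hTeq]
    exact le_of_tendsto ((continuous_abs.tendsto _).comp hlim) (Eventually.of_forall hTn_bound)
  -- **Riesz on each coordinate direction**
  have hRiesz : ∀ j : Fin 3, ∃ G : (EuclideanSpace ℝ (Fin 3)) → ℝ, MemLp G 2 (volume.restrict (ball x₀ ρ)) ∧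
      eLpNorm G 2 (volume.restrict (ball x₀ ρ)) ≤ M ∧
      ∀ φ : (EuclideanSpace ℝ (Fin 3)) → ℝ, IsTestFunctionOn (⟨ball x₀ ρ, isOpen_ball⟩ : Opens (EuclideanSpace ℝ (Fin 3))) φ →
        ∫ x in ball x₀ ρ, fderiv ℝ φ x (EuclideanSpace.single j (1 : ℝ)) * f x = -∫ x in ball x₀ ρ, G x * φ x := by
    intro j
    set Λ : ((EuclideanSpace ℝ (Fin 3)) → ℝ) → ℝ := fun φ => -∫ x in ball x₀ ρ, fderiv ℝ φ x (EuclideanSpace.single j (1 : ℝ)) * f x with hΛ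
    have hint : ∀ {φ : (EuclideanSpace ℝ (Fin 3)) → ℝ}, IsTestFunctionOn (⟨ball x₀ ρ, isOpen_ball⟩ : Opens (EuclideanSpace ℝ (Fin 3))) φ →
        Integrable (fun x => fderiv ℝ φ x (EuclideanSpace.single j (1 : ℝ)) * f x) (volume.restrict (ball x₀ ρ)) := by
      intro φ hφ
      have hφ1 : ContDiff ℝ 1 φ := hφ.contDiff.of_le (by exact_mod_cast le_top)
      have hc : Continuous fun x => fderiv ℝ φ x (EuclideanSpace.single j (1 : ℝ)) := (hφ1.continuous_fderiv one_ne_zero).clm_apply continuous_const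
      obtain ⟨C₀, hC₀⟩ := hc.bounded_above_of_compact_support (hφ.hasCompactSupport.fderiv_apply (𝕜 := ℝ) _)
      refine (hfρi.norm.const_mul C₀).mono' (hc.aestronglyMeasurable.mul hfρi.1) ?_
      refine Eventually.of_forall fun x => ?_
      rw [norm_mul]
      exact mul_le_mul_of_nonneg_right (hC₀ x) (norm_nonneg _)
    have hdiffφ : ∀ {φ : (EuclideanSpace ℝ (Fin 3)) → ℝ}, IsTestFunctionOn (⟨ball x₀ ρ, isOpen_ball⟩ : Opens (EuclideanSpace ℝ (Fin 3))) φ →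
        Differentiable ℝ φ := fun hφ => hφ.contDiff.differentiable (by simp)
    have hadd : ∀ φ₁ φ₂ : (EuclideanSpace ℝ (Fin 3)) → ℝ, IsTestFunctionOn (⟨ball x₀ ρ, isOpen_ball⟩ : Opens (EuclideanSpace ℝ (Fin 3))) φ₁ →
        IsTestFunctionOn (⟨ball x₀ ρ, isOpen_ball⟩ : Opens (EuclideanSpace ℝ (Fin 3))) φ₂ → Λ (φ₁ + φ₂) = Λ φ₁ + Λ φ₂ := by
      intro φ₁ φ₂ h₁ h₂
      simp only [hΛ]
      rw [← neg_add, ← integral_add (hint h₁) (hint h₂)]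
      congr 1
      refine integral_congr_ae (Eventually.of_forall fun x => ?_)
      show fderiv ℝ (φ₁ + φ₂) x (EuclideanSpace.single j (1 : ℝ)) * f x = fderiv ℝ φ₁ x (EuclideanSpace.single j (1 : ℝ)) * f x + fderiv ℝ φ₂ x (EuclideanSpace.single j (1 : ℝ)) * f x
      rw [fderiv_add (hdiffφ h₁ x) (hdiffφ h₂ x)]
      simp only [_root_.add_apply]
      ring
    have hsmul : ∀ (a : ℝ) (φ : (EuclideanSpace ℝ (Fin 3)) → ℝ), IsTestFunctionOn (⟨ball x₀ ρ, isOpen_ball⟩ : Opens (EuclideanSpace ℝ (Fin 3))) φ →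
        Λ (a • φ) = a * Λ φ := by
      intro a φ hφ
      simp only [hΛ]
      rw [mul_neg, ← integral_const_mul]
      congr 1
      refine integral_congr_ae (Eventually.of_forall fun x => ?_)
      show fderiv ℝ (a • φ) x (EuclideanSpace.single j (1 : ℝ)) * f x = a * (fderiv ℝ φ x (EuclideanSpace.single j (1 : ℝ)) * f x)
      rw [fderiv_const_smul (hdiffφ hφ x)]
      simp only [_root_.smul_apply, smul_eq_mul]
      ring
    have hbd : ∀ φ : (EuclideanSpace ℝ (Fin 3)) → ℝ, IsTestFunctionOn (⟨ball x₀ ρ, isOpen_ball⟩ : Opens (EuclideanSpace ℝ (Fin 3))) φ →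
        |Λ φ| ≤ M.toReal * (eLpNorm φ 2 (volume.restrict (ball x₀ ρ))).toReal := by
      intro φ hφ
      simp only [hΛ, abs_neg]
      have h := hpair (EuclideanSpace.single j (1 : ℝ)) φ hφ
      have hn1 : ‖(EuclideanSpace.single j (1 : ℝ) : (EuclideanSpace ℝ (Fin 3)))‖ = 1 := by simp
      rw [hn1, one_mul] at h
      exact h
    obtain ⟨G, hGm, hGn, hGrep⟩ := HeatDivForm.exists_memLp_two_repr_of_test_bound (volume : Measure (EuclideanSpace ℝ (Fin 3)))
      (⟨ball x₀ ρ, isOpen_ball⟩ : Opens (EuclideanSpace ℝ (Fin 3))) Λ hadd hsmul ENNReal.toReal_nonneg hbd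
    refine ⟨G, hGm, hGn.trans (le_of_eq (ENNReal.ofReal_toReal hMtop)), fun φ hφ => ?_⟩
    have h := hGrep φ hφ
    simp only [hΛ] at h
    have h2 : -∫ x in ball x₀ ρ, fderiv ℝ φ x (EuclideanSpace.single j (1 : ℝ)) * f x = ∫ x in ball x₀ ρ, G x * φ x := h
    rw [← h2, neg_neg]
  choose G hGm hGn hGrep using hRiesz
  -- **the weak derivative**
  set g : (EuclideanSpace ℝ (Fin 3)) → (EuclideanSpace ℝ (Fin 3)) →L[ℝ] ℝ := fun x => ∑ j, G j x • (EuclideanSpace.proj j : (EuclideanSpace ℝ (Fin 3)) →L[ℝ] ℝ) with hg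
  have hpr : ∀ (j : Fin 3) (w : (EuclideanSpace ℝ (Fin 3))), (EuclideanSpace.proj j : (EuclideanSpace ℝ (Fin 3)) →L[ℝ] ℝ) w = w j := fun j w => rfl
  have hg_apply : ∀ x v, g x v = ∑ j, v j * G j x := fun x v => by
    have h1 : g x v = ∑ j, (G j x • (EuclideanSpace.proj j : (EuclideanSpace ℝ (Fin 3)) →L[ℝ] ℝ)) v := by
      simp only [hg]
      exact map_sum (ContinuousLinearMap.apply ℝ ℝ v)
        (fun j => G j x • (EuclideanSpace.proj j : (EuclideanSpace ℝ (Fin 3)) →L[ℝ] ℝ)) Finset.univ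
    rw [h1]
    refine Finset.sum_congr rfl fun j _ => ?_
    show G j x • (EuclideanSpace.proj j : (EuclideanSpace ℝ (Fin 3)) →L[ℝ] ℝ) v = v j * G j x
    rw [hpr, smul_eq_mul, mul_comm]
  have hg_single : ∀ x (j : Fin 3), g x (EuclideanSpace.single j (1 : ℝ)) = G j x := fun x j => by
    rw [hg_apply]
    rw [Finset.sum_eq_single j]
    · simp
    · intro i _ hij
      simp [hij]
    · simp
  have hGae : ∀ j, AEStronglyMeasurable (G j) (volume.restrict (ball x₀ ρ)) := fun j => (hGm j).1
  have hgae : AEStronglyMeasurable g (volume.restrict (ball x₀ ρ)) :=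
    Finset.aestronglyMeasurable_fun_sum _ fun j _ => (hGae j).smul_const _
  have hg_norm : ∀ x, ‖g x‖ ≤ ‖∑ j, |G j x|‖ := by
    intro x
    rw [Real.norm_of_nonneg (Finset.sum_nonneg fun j _ => abs_nonneg _)]
    refine (norm_sum_le _ _).trans (Finset.sum_le_sum fun j _ => ?_)
    rw [norm_smul, Real.norm_eq_abs]
    refine mul_le_of_le_one_right (abs_nonneg _) ?_
    refine ContinuousLinearMap.opNorm_le_bound _ zero_le_one fun y => ?_
    rw [one_mul, hpr]
    exact PiLp.norm_apply_le y j
  have hsum2 : eLpNorm (fun x => ∑ j, |G j x|) 2 (volume.restrict (ball x₀ ρ)) ≤ ∑ _j : Fin 3, M := by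
    have : (fun x => ∑ j, |G j x|) = ∑ j, fun x => |G j x| := by funext x; simp
    rw [this]
    refine (eLpNorm_sum_le (fun j _ => (hGae j).norm.congr (Eventually.of_forall fun x => by
      simp [Real.norm_eq_abs])) one_le_two).trans (Finset.sum_le_sum fun j _ => ?_)
    rw [show (fun x => |G j x|) = fun x => ‖G j x‖ from funext fun x => (Real.norm_eq_abs _).symm,
      eLpNorm_norm]
    exact hGn j
  have hgN : eLpNorm g 2 (volume.restrict (ball x₀ ρ)) ≤ 3 * M := by
    refine (eLpNorm_mono hg_norm).trans (hsum2.trans (le_of_eq ?_))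
    rw [Finset.sum_const, Finset.card_univ, Fintype.card_fin]
    simp [nsmul_eq_mul]
  have hg2 : MemLp g 2 (volume.restrict (ball x₀ ρ)) :=
    ⟨hgae, hgN.trans_lt (ENNReal.mul_lt_top (by norm_num) hMtop.lt_top)⟩
  refine ⟨g, ?_, hg2, ?_, ?_⟩
  · -- the weak derivative identity
    have hfIO : IntegrableOn f (ball x₀ ρ) volume := hfρi
    have hgIO : IntegrableOn g (ball x₀ ρ) volume := hg2.integrable one_le_two
    refine ⟨hfIO.locallyIntegrableOn, hgIO.locallyIntegrableOn, fun φ v hφ => ?_⟩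
    have hφd : Differentiable ℝ φ := hφ.contDiff.differentiable (by simp)
    have hexp : ∀ x, fderiv ℝ φ x v = ∑ j, v j * fderiv ℝ φ x (EuclideanSpace.single j (1 : ℝ)) := by
      intro x
      conv_lhs => rw [eq_sum_coord_smul_single v]
      rw [map_sum]
      exact Finset.sum_congr rfl fun j _ => by rw [map_smul, smul_eq_mul]
    have hintj : ∀ j : Fin 3, Integrable (fun x => v j * (fderiv ℝ φ x (EuclideanSpace.single j (1 : ℝ)) * f x))
        (volume.restrict (ball x₀ ρ)) := by
      intro j
      have hφ1 : ContDiff ℝ 1 φ := hφ.contDiff.of_le (by exact_mod_cast le_top)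
      have hc : Continuous fun x => fderiv ℝ φ x (EuclideanSpace.single j (1 : ℝ)) := (hφ1.continuous_fderiv one_ne_zero).clm_apply continuous_const
      obtain ⟨C₀, hC₀⟩ := hc.bounded_above_of_compact_support (hφ.hasCompactSupport.fderiv_apply (𝕜 := ℝ) _)
      refine ((hfρi.norm.const_mul C₀).mono' (hc.aestronglyMeasurable.mul hfρi.1) ?_).const_mul _
      refine Eventually.of_forall fun x => ?_
      show ‖fderiv ℝ φ x (EuclideanSpace.single j (1 : ℝ)) * f x‖ ≤ C₀ * ‖f x‖
      rw [norm_mul]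
      exact mul_le_mul_of_nonneg_right (hC₀ x) (norm_nonneg _)
    have hintG : ∀ j : Fin 3, Integrable (fun x => v j * (G j x * φ x)) (volume.restrict (ball x₀ ρ)) := by
      intro j
      obtain ⟨C₀, hC₀⟩ := hφ.contDiff.continuous.bounded_above_of_compact_support hφ.hasCompactSupport
      have hGi : Integrable (G j) (volume.restrict (ball x₀ ρ)) := (hGm j).integrable one_le_two
      refine ((hGi.norm.mul_const C₀).mono' (hGi.1.mul hφ.contDiff.continuous.aestronglyMeasurable) ?_).const_mul _
      refine Eventually.of_forall fun x => ?_
      show ‖G j x * φ x‖ ≤ ‖G j x‖ * C₀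
      rw [norm_mul]
      exact mul_le_mul_of_nonneg_left (hC₀ x) (norm_nonneg _)
    calc ∫ x in ball x₀ ρ, fderiv ℝ φ x v • f x
        = ∫ x in ball x₀ ρ, ∑ j, v j * (fderiv ℝ φ x (EuclideanSpace.single j (1 : ℝ)) * f x) := by
          refine integral_congr_ae (Eventually.of_forall fun x => ?_)
          simp only [smul_eq_mul, hexp, Finset.sum_mul, mul_assoc]
      _ = ∑ j, v j * ∫ x in ball x₀ ρ, fderiv ℝ φ x (EuclideanSpace.single j (1 : ℝ)) * f x := by
          rw [integral_finsetSum _ fun j _ => hintj j]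
          exact Finset.sum_congr rfl fun j _ => integral_const_mul _ _
      _ = ∑ j, v j * -∫ x in ball x₀ ρ, G j x * φ x := by
          exact Finset.sum_congr rfl fun j _ => by rw [hGrep j φ hφ]
      _ = -∫ x in ball x₀ ρ, ∑ j, v j * (G j x * φ x) := by
          rw [integral_finsetSum _ fun j _ => hintG j, ← Finset.sum_neg_distrib]
          exact Finset.sum_congr rfl fun j _ => by rw [integral_const_mul, mul_neg]
      _ = -∫ x in ball x₀ ρ, φ x • g x v := by
          congr 1
          refine integral_congr_ae (Eventually.of_forall fun x => ?_)
          simp only [smul_eq_mul, hg_apply, Finset.mul_sum]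
          exact Finset.sum_congr rfl fun j _ => by ring
  · -- the norm bound
    rw [hCeq]
    calc eLpNorm g 2 (volume.restrict (ball x₀ ρ)) ≤ 3 * M := hgN
      _ = 3 * A * (Nf + NF) := by rw [hM, mul_assoc]
  · -- the gradient-form weak equation on the small ball
    intro φ hφ
    set b : OrthonormalBasis (Fin 3) ℝ (EuclideanSpace ℝ (Fin 3)) := EuclideanSpace.basisFun (Fin 3) ℝ with hb
    have hbi : ∀ i, b i = EuclideanSpace.single i (1 : ℝ) := fun i => by rw [hb, EuclideanSpace.basisFun_apply]
    have hφR : IsTestFunctionOn (⟨ball x₀ R, isOpen_ball⟩ : Opens (EuclideanSpace ℝ (Fin 3))) φ :=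
      hφ.mono (fun x hx => hρR hx)
    have hφ2c : ContDiff ℝ 2 φ := hφ.contDiff.of_le (by norm_cast)
    -- the derivatives `∂ⱼφ` are test functions on the small ball
    have hφj : ∀ j : Fin 3, IsTestFunctionOn (⟨ball x₀ ρ, isOpen_ball⟩ : Opens (EuclideanSpace ℝ (Fin 3))) fun x => fderiv ℝ φ x (EuclideanSpace.single j (1 : ℝ)) := by
      intro j
      refine ⟨contDiff_infty.2 fun n =>
          (hφ.contDiff.fderiv_right (m := n) (by exact_mod_cast le_top)).clm_apply contDiff_const,
        hφ.hasCompactSupport.fderiv_apply (𝕜 := ℝ) _, ?_⟩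
      exact (tsupport_fderiv_apply_subset ℝ (EuclideanSpace.single j (1 : ℝ))).trans hφ.tsupport_subset
    -- `∫ g(∇φ) = Σⱼ ∫ Gⱼ ∂ⱼφ = -Σⱼ ∫ (∂ⱼ∂ⱼφ) f = -∫ f Δφ`
    have hintGj : ∀ j : Fin 3, Integrable (fun x => fderiv ℝ φ x (EuclideanSpace.single j (1 : ℝ)) * G j x) (volume.restrict (ball x₀ ρ)) := by
      intro j
      have hc : Continuous fun x => fderiv ℝ φ x (EuclideanSpace.single j (1 : ℝ)) := (hφj j).contDiff.continuous
      obtain ⟨C₀, hC₀⟩ := hc.bounded_above_of_compact_support (hφj j).hasCompactSupport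
      have hGi : Integrable (G j) (volume.restrict (ball x₀ ρ)) := (hGm j).integrable one_le_two
      refine (hGi.norm.const_mul C₀).mono' (hc.aestronglyMeasurable.mul hGi.1) ?_
      refine Eventually.of_forall fun x => ?_
      rw [norm_mul]
      exact mul_le_mul_of_nonneg_right (hC₀ x) (norm_nonneg _)
    have e1 : ∫ x in ball x₀ ρ, g x (gradient φ x) = ∑ j, ∫ x in ball x₀ ρ, fderiv ℝ φ x (EuclideanSpace.single j (1 : ℝ)) * G j x := by
      rw [← integral_finsetSum _ fun j _ => hintGj j]
      refine integral_congr_ae (Eventually.of_forall fun x => ?_)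
      show g x (gradient φ x) = ∑ j, fderiv ℝ φ x (EuclideanSpace.single j (1 : ℝ)) * G j x
      rw [clm_gradient_eq_sum]
      exact Finset.sum_congr rfl fun j _ => by rw [hg_single]
    have e2 : ∀ j : Fin 3, ∫ x in ball x₀ ρ, fderiv ℝ φ x (EuclideanSpace.single j (1 : ℝ)) * G j x =
        -∫ x in ball x₀ ρ, fderiv ℝ (fun y => fderiv ℝ φ y (EuclideanSpace.single j (1 : ℝ))) x (EuclideanSpace.single j (1 : ℝ)) * f x := by
      intro j
      have h := hGrep j _ (hφj j)
      rw [h, neg_neg]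
      exact integral_congr_ae (Eventually.of_forall fun x => mul_comm _ _)
    have hintjj : ∀ j : Fin 3, Integrable (fun x => fderiv ℝ (fun y => fderiv ℝ φ y (EuclideanSpace.single j (1 : ℝ))) x (EuclideanSpace.single j (1 : ℝ)) * f x)
        (volume.restrict (ball x₀ ρ)) := by
      intro j
      have hc : Continuous fun x => fderiv ℝ (fun y => fderiv ℝ φ y (EuclideanSpace.single j (1 : ℝ))) x (EuclideanSpace.single j (1 : ℝ)) :=
        ((hφj j).contDiff.continuous_fderiv (by simp)).clm_apply continuous_const
      obtain ⟨C₀, hC₀⟩ := hc.bounded_above_of_compact_support ((hφj j).hasCompactSupport.fderiv_apply (𝕜 := ℝ) _)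
      refine (hfρi.norm.const_mul C₀).mono' (hc.aestronglyMeasurable.mul hfρi.1) ?_
      refine Eventually.of_forall fun x => ?_
      rw [norm_mul]
      exact mul_le_mul_of_nonneg_right (hC₀ x) (norm_nonneg _)
    have e3 : ∑ j, ∫ x in ball x₀ ρ, fderiv ℝ (fun y => fderiv ℝ φ y (EuclideanSpace.single j (1 : ℝ))) x (EuclideanSpace.single j (1 : ℝ)) * f x =
        ∫ x in ball x₀ ρ, f x * (Δ φ) x := by
      rw [← integral_finsetSum _ fun j _ => hintjj j]
      refine integral_congr_ae (Eventually.of_forall fun x => ?_)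
      show ∑ j, fderiv ℝ (fun y => fderiv ℝ φ y (EuclideanSpace.single j (1 : ℝ))) x (EuclideanSpace.single j (1 : ℝ)) * f x = f x * (Δ φ) x
      rw [laplacian_eq_sum_fderiv_fderiv b hφ2c x, Finset.mul_sum]
      refine Finset.sum_congr rfl fun j _ => ?_
      rw [hbi, mul_comm]
    -- the very weak equation, moved to the small ball
    have hΔ0 : ∀ x ∉ ball x₀ ρ, (Δ φ) x = 0 := fun x hx =>
      laplacian_eq_zero_of_notMem_tsupport fun h => hx (hφ.tsupport_subset h)
    have hg0 : ∀ x ∉ ball x₀ ρ, gradient φ x = 0 := fun x hx =>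
      gradient_eq_zero_of_notMem_tsupport fun h => hx (hφ.tsupport_subset h)
    have e4 : ∫ x in ball x₀ ρ, f x * (Δ φ) x = ∫ x in ball x₀ R, f x * (Δ φ) x := by
      rw [setIntegral_eq_integral_of_forall_compl_eq_zero fun x hx => by rw [hΔ0 x hx, mul_zero],
        setIntegral_eq_integral_of_forall_compl_eq_zero fun x hx => by
          rw [hΔ0 x fun h => hx (hρR h), mul_zero]]
    have e5 : ∫ x in ball x₀ R, ⟪F x, gradient φ x⟫ = ∫ x in ball x₀ ρ, ⟪F x, gradient φ x⟫ := by
      rw [setIntegral_eq_integral_of_forall_compl_eq_zero fun x hx => by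
          rw [hg0 x fun h => hx (hρR h)]; simp,
        setIntegral_eq_integral_of_forall_compl_eq_zero fun x hx => by rw [hg0 x hx]; simp]
    rw [e1, Finset.sum_congr rfl fun j _ => e2 j, Finset.sum_neg_distrib, e3, e4, heq φ hφR, neg_neg, e5]

end LaplaceVeryWeak

end Literature.Analysis.FluidPDE

end
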